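import Literature.RingTheory.HilbertSamuel.TangentConeInitialForms
import Literature.RingTheory.HilbertSamuel.InitialFormOfElement
import Literature.RingTheory.HilbertSamuel.HilbertFunctionBaseChange
import Literature.RingTheory.HilbertSamuel.Quotient
import Literature.RingTheory.HilbertSamuel.HilbertSamuelFunction
import Literature.RingTheory.HilbertSamuel.PolynomialRing
import Literature.RingTheory.HilbertSamuel.DirectrixLocal
import Summits.ResolutionOfSingularities.ResolutionOfSingularities.Theorems.HilbertSamuelEliminationSigmaMaxModificationsCorridor3HypersurfaceValues
import HarnessLib

/-!
# Route `HilbertSamuelElimination`, crux `SigmaMaxModificationsCorridor3`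
# (stmt-ResolutionOfSingularities-19249; child of `SigmaMaxModifications` stmt-…-18506),
# line `tame_wild`, helper H1 of `stub_tameNu3`: Hilbert-function rigidity of hypersurfaces

[OURS · L1 W4.2] Helper H1 of the chain's plan of record (`L/w42/CRUX-PLAN.md` v1 §2,
`stub_H1_hypersurface_of_hilbertFun`): it replaces the role of the first-order local structure
statement "a point of a `p`-tame Hilbert–Samuel stratum is a hypersurface singularity of
multiplicity `m`" used by step (1) of `stub_tameNu3`; NOT a statement of any manuscript.

**Theorem (ring level).** Let `S` be a regular local ring of dimension `e`, `f : S → A` a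
surjection onto a local ring `A`, and suppose the Hilbert function of `A` is that of a
hypersurface of multiplicity `m ≥ 1` in embedding dimension `e`:
`H^{(0)}_A(n) + Φ^{(e)}(n - m)·[m ≤ n] = Φ^{(e)}(n)` for all `n` (`Φ^{(e)} = iterPSum e Phi`, the
Hilbert function of `k[X_1, …, X_e]`, CJS Def. 2.13). Then `ker f = (g)` for an element `g` of
order exactly `m` (`g ∈ 𝔪^m ∖ 𝔪^{m+1}`):
`exists_ker_eq_span_singleton_of_hilbertFun`; in the closed binomial form typed by the planner
(`hilbertFun A = hypersurfaceHFe e m`, `…Corridor3HelpersDefs.lean`):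
`stub_H1_hypersurface_of_hilbertFun` (signature verbatim from `L/w42/helpers-v1.lean`); and read
at a point `y` of a Hilbert–Samuel stratum `Y(hypersurfaceHFe (N+1) m)` through H1″
(`hilbertFun_eq_hypersurfaceHFe_of_hsFun_eq`, `…Corridor3HypersurfaceValues.lean`):
`exists_ker_eq_span_singleton_of_mem_hsStratum` — every surjection onto `𝒪_{Y,y}` from a regular
local ring of dimension `ψ_Y(y) + 1` has principal kernel generated by an element of order `m`.

**Proof.** With a regular system of parameters `x` of `S` (`gr_𝔪(S) = k[X]`, `W_d(S) = 0`) and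
`I = ker f`:
* `dim_k cl_d(J) + H^{(0)}_{S/J}(d) = #Mon_d` for every ideal `J` (the presentation
  `gr(S/J) = k[X]/In_𝔪(J)` degreewise, CJS §2.2: tree `symbolForms_quotient_eq_image_initialForms`,
  `finrank_symbolKer_add_hilbertFun`, transported along `k(S) ≅ k(S/J)` by `finrank_span_image_eq`)
  — `finrank_initialForms_add_hilbertFun_quotient`;
* at `d = m` this gives `dim cl_m(I) = 1`, so a non-zero initial form `F ∈ cl_m(I)`, which lifts
  to `g ∈ I` of order exactly `m` (`W_m(S) = 0`);
* `F · k[X]_n ⊆ cl_{n+m}((g))` and `k[X]` is a domain, so `dim cl_{m+n}((g)) ≥ #Mon_n` and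
  `H^{(0)}_{S/(g)} ≤ H^{(0)}_A`; the surjection `S/(g) → A` gives `H^{(0)}_A ≤ H^{(0)}_{S/(g)}`
  (CJS Lemma 2.24), so equality holds and `S/(g) → A` is injective (CJS Lemma 2.24, equality
  case: tree `ker_algebraMap_eq_bot_of_hilbertFun_eq`), i.e. `ker f = (g)`.

## Sources

* V. Cossart, U. Jannsen, S. Saito, *Desingularization: Invariants and Strategy*, LNM 2270
  (2020), §2.2 (p. 24, 27: `gr_𝔪(R/J) = k[X]/In_𝔪(J)`, `H^{(0)}`), Def. 2.13, Lemma 2.23,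
  Lemma 2.24. [CossartJannsenSaito2020]
-/

set_option linter.dupNamespace false -- mandated namespace of this single-conjunct summit

noncomputable section

open IsLocalRing MvPolynomial AlgebraicGeometry
open Literature.RingTheory.HilbertSamuel Literature.RingTheory.MvPolynomial
open Literature.AlgebraicGeometry.Resolution
open Summit.ResolutionOfSingularities.ResolutionOfSingularities.Theorems.SigmaMaxModificationsCorridor3.TameWild

namespace Summit.ResolutionOfSingularities.ResolutionOfSingularities.Theorems.SigmaMaxModificationsCorridor3.Helpers

universe u v

/-! ## `#Mon_d = Φ^{(e)}(d)` -/

/-- The number of monomials of degree `d` in `e` variables is `Φ^{(e)}(d) = binom(d+e-1, d)`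
(CJS Def. 2.13). [cite: CossartJannsenSaito2020, Def. 2.13] -/
theorem card_monomialsOfDegree_eq_iterPSum (e d : ℕ) :
    Nat.card (monomialsOfDegree e d) = iterPSum e Phi d := by
  rw [card_monomialsOfDegree, iterPSum_Phi_eq_choose, Nat.add_comm]

/-! ## `dim_k cl_d(J) + H^{(0)}_{A/J}(d) = #Mon_d` -/

section Quotient

variable {A : Type u} [CommRing A] [IsLocalRing A] {e : ℕ} (x : Fin e → A)
  (hx : Ideal.span (Set.range x) = maximalIdeal A)

/-- `cl_d(J)` consists of forms of degree `d`. [folklore] -/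
theorem initialForms_le_homogeneousSubmodule (J : Ideal A) (d : ℕ) :
    initialForms x J d ≤ homogeneousSubmodule (Fin e) (ResidueField A) d :=
  fun _ hG => (mem_homogeneousSubmodule _ _).mpr (isHomogeneous_of_mem_initialForms x hG)

/-- `cl_d(J)` is finite-dimensional. [folklore] -/
theorem finiteDimensional_initialForms (J : Ideal A) (d : ℕ) :
    FiniteDimensional (ResidueField A) (initialForms x J d) := by
  haveI := finite_homogeneousSubmodule (K := ResidueField A) (σ := Fin e) d
  exact Submodule.finiteDimensional_of_le (initialForms_le_homogeneousSubmodule x J d)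

include hx in
/-- **`dim_k cl_d(J) + H^{(0)}_{A/J}(d) = #Mon_d`** for a noetherian local ring `A` with `𝔪`
generated by `x_1, …, x_e` and a proper ideal `J`: the degree-`d` piece of
`gr_𝔪̄(A/J) = k[X_1, …, X_e]/J_{A/J}` has dimension `H^{(0)}_{A/J}(d)`, and `(J_{A/J})_d = W_d(A/J)`
is the image of `cl_d(J)` along `k(A) ≅ k(A/J)` (CJS §2.2, `gr_𝔪(R/J) = gr_𝔪(R)/In_𝔪(J)`).
[cite: CossartJannsenSaito2020, §2.2 (p. 24, 27)] -/
theorem finrank_initialForms_add_hilbertFun_quotient [IsNoetherianRing A] (J : Ideal A)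
    [Nontrivial (A ⧸ J)] (d : ℕ) :
    Module.finrank (ResidueField A) (initialForms x J d) + hilbertFun (A ⧸ J) d =
      Nat.card (monomialsOfDegree e d) := by
  have h := finrank_symbolKer_add_hilbertFun (fun i => Ideal.Quotient.mk J (x i))
    (span_range_mk_comp_eq x hx J) d
  rw [← finrank_symbolForms] at h
  rw [← h]
  congr 1
  have hspan : symbolForms (fun i => Ideal.Quotient.mk J (x i)) (span_range_mk_comp_eq x hx J) d =
      Submodule.span (ResidueField (A ⧸ J))
        (MvPolynomial.map (ResidueField.map (Ideal.Quotient.mk J)) ''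
          (initialForms x J d : Set (MvPolynomial (Fin e) (ResidueField A)))) := by
    rw [← symbolForms_quotient_eq_image_initialForms x hx J d, Submodule.span_eq]
  haveI := finiteDimensional_initialForms x J d
  rw [hspan, finrank_span_image_eq (ResidueField.map (Ideal.Quotient.mk J)) (initialForms x J d)
    (initialForms_le_homogeneousSubmodule x J d)]

/-- Products of a form `G` of degree `m` with `G(x) ∈ J` by forms of degree `n` are initial forms
of `J` of degree `m + n`: `Ḡ · k[X]_n ⊆ cl_{m+n}(J)`. [cite: CossartJannsenSaito2020, §2.2 (p. 24)] -/
theorem map_mul_mem_initialForms {J : Ideal A} {m n : ℕ} {G : MvPolynomial (Fin e) A}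
    (hG : G.IsHomogeneous m) (hGJ : eval x G ∈ J) {Q : MvPolynomial (Fin e) (ResidueField A)}
    (hQ : Q.IsHomogeneous n) :
    MvPolynomial.map (residue A) G * Q ∈ initialForms x J (m + n) := by
  obtain ⟨Q', hQ', rfl⟩ := exists_isHomogeneous_map_residue_eq (A := A) hQ
  refine ⟨G * Q', hG.mul hQ', ?_, by rw [map_mul]⟩
  rw [map_mul]
  exact Ideal.mul_mem_right _ _ hGJ

/-- Hence **`#Mon_n ≤ dim_k cl_{m+n}(J)`** as soon as `J` contains the value `G(x)` of a form `G` of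
degree `m` with non-zero reduction `Ḡ` (`Q ↦ Ḡ Q` is injective on `k[X]_n`, `k[X]` being a
domain). [cite: CossartJannsenSaito2020, §2.2 (p. 24)] -/
theorem card_le_finrank_initialForms {J : Ideal A} {m : ℕ} {G : MvPolynomial (Fin e) A}
    (hG : G.IsHomogeneous m) (hGJ : eval x G ∈ J) (hG0 : MvPolynomial.map (residue A) G ≠ 0)
    (n : ℕ) :
    Nat.card (monomialsOfDegree e n) ≤
      Module.finrank (ResidueField A) (initialForms x J (m + n)) := by
  set k := ResidueField A
  let μ : MvPolynomial (Fin e) k →ₗ[k] MvPolynomial (Fin e) k :=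
    LinearMap.mulLeft k (MvPolynomial.map (residue A) G)
  have hinj : Function.Injective μ := fun a b h =>
    mul_right_injective₀ hG0 (by simpa only [μ, LinearMap.mulLeft_apply] using h)
  have hle : (homogeneousSubmodule (Fin e) k n).map μ ≤ initialForms x J (m + n) := by
    rintro _ ⟨Q, hQ, rfl⟩
    exact map_mul_mem_initialForms x hG hGJ ((mem_homogeneousSubmodule _ _).mp hQ)
  haveI := finiteDimensional_initialForms x J (m + n)
  calc Nat.card (monomialsOfDegree e n)
      = Module.finrank k (homogeneousSubmodule (Fin e) k n) := by
        rw [finrank_homogeneousSubmodule_fin, card_monomialsOfDegree, Nat.add_comm]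
    _ = Module.finrank k ((homogeneousSubmodule (Fin e) k n).map μ) :=
        LinearEquiv.finrank_eq (Submodule.equivMapOfInjective μ hinj _)
    _ ≤ Module.finrank k (initialForms x J (m + n)) := Submodule.finrank_mono hle

end Quotient

/-! ## Regular ambient ring: lifting a non-zero initial form, and the rigidity theorem -/

section Regular

variable {S : Type u} [CommRing S] [IsRegularLocalRing S] {e : ℕ}
  (hd : (maximalIdeal S).spanFinrank = e) (x : Fin e → S)
  (hx : Ideal.span (Set.range x) = maximalIdeal S)

include hd in
/-- `W_d(S) = 0` for a regular local ring in a regular system of parameters (`gr_𝔪(S) = k[X]`).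
[cite: CossartJannsenSaito2020, §2.2 (p. 24)] -/
theorem symbolForms_eq_bot_of_isRegularLocalRing (d : ℕ) : symbolForms x hx d = ⊥ := by
  have h := tangentConeIdeal_eq_bot_of_isRegularLocalRing hd x hx
  rw [tangentConeIdeal, Ideal.span_eq_bot] at h
  exact (Submodule.eq_bot_iff _).mpr fun w hw => h w (Set.mem_iUnion.mpr ⟨d, hw⟩)

include hd hx in
/-- **A non-zero initial form of degree `m` of `J` lifts to an element of `J` of order exactly
`m`**: `F = Ḡ` with `G` a form of degree `m`, `g = G(x) ∈ J ∩ 𝔪^m`, and `g ∉ 𝔪^{m+1}` because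
`F ∉ W_m(S) = 0`. [cite: CossartJannsenSaito2020, §2.2 (p. 24)] -/
theorem exists_eval_eq_of_mem_initialForms {J : Ideal S} {m : ℕ}
    {F : MvPolynomial (Fin e) (ResidueField S)} (hF : F ∈ initialForms x J m) (hF0 : F ≠ 0) :
    ∃ G : MvPolynomial (Fin e) S, G.IsHomogeneous m ∧ eval x G ∈ J ∧
      MvPolynomial.map (residue S) G = F ∧ eval x G ∈ maximalIdeal S ^ m ∧
      eval x G ∉ maximalIdeal S ^ (m + 1) := by
  obtain ⟨G, hG, hGJ, rfl⟩ := hF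
  refine ⟨G, hG, hGJ, rfl, eval_mem_pow_of_isHomogeneous x hx hG, fun hmem => hF0 ?_⟩
  have hGin : MvPolynomial.map (residue S) G ∈ initialFormsOf x (eval x G) m := ⟨G, hG, rfl, rfl⟩
  have hW := (mem_pow_succ_iff_of_mem_initialFormsOf x hx hGin).mp hmem
  rwa [symbolForms_eq_bot_of_isRegularLocalRing hd x hx m, Submodule.mem_bot] at hW

include hd hx in
/-- **Rigidity, quotient form.** For a regular local ring `S` with regular parameters
`x_1, …, x_e` and a proper ideal `I` such that
`H^{(0)}_{S/I}(n) + #Mon_{n-m}·[m ≤ n] = #Mon_n` for all `n` (`m ≥ 1`): `I = (g)` with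
`g ∈ 𝔪^m ∖ 𝔪^{m+1}`. [cite: CossartJannsenSaito2020, §2.2 (p. 24, 27), Lemma 2.24] -/
theorem eq_span_singleton_of_hilbertFun_quotient (I : Ideal S) [Nontrivial (S ⧸ I)] {m : ℕ}
    (hm : 1 ≤ m)
    (hH : ∀ n, hilbertFun (S ⧸ I) n +
      (if m ≤ n then Nat.card (monomialsOfDegree e (n - m)) else 0) =
        Nat.card (monomialsOfDegree e n)) :
    ∃ g : S, I = Ideal.span {g} ∧ g ∈ maximalIdeal S ^ m ∧ g ∉ maximalIdeal S ^ (m + 1) := by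
  -- Step 1: `dim cl_m(I) = 1`, so there is a non-zero initial form of degree `m`
  have h1 : Module.finrank (ResidueField S) (initialForms x I m) = 1 := by
    have h := finrank_initialForms_add_hilbertFun_quotient x hx I m
    have hHm := hH m
    rw [if_pos le_rfl, Nat.sub_self, card_monomialsOfDegree, Nat.choose_zero_right] at hHm
    omega
  have hne : initialForms x I m ≠ ⊥ := by
    intro hbot
    rw [hbot, finrank_bot] at h1
    exact zero_ne_one h1
  obtain ⟨F, hFI, hF0⟩ := Submodule.exists_mem_ne_zero_of_ne_bot hne
  -- Step 2: lift it to `g ∈ I` of order exactly `m`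
  obtain ⟨G, hG, hGI, hGF, hgm, hgm'⟩ := exists_eval_eq_of_mem_initialForms hd x hx hFI hF0
  refine ⟨eval x G, ?_, hgm, hgm'⟩
  have hG0 : MvPolynomial.map (residue S) G ≠ 0 := hGF ▸ hF0
  have hle : Ideal.span {eval x G} ≤ I := (Ideal.span_singleton_le_iff_mem _).mpr hGI
  have hgmax : eval x G ∈ maximalIdeal S :=
    Ideal.pow_le_self (Nat.pos_iff_ne_zero.mp hm) hgm
  haveI : Nontrivial (S ⧸ Ideal.span {eval x G}) :=
    Ideal.Quotient.nontrivial_iff.mpr (by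
      rw [Ne, Ideal.span_singleton_eq_top]
      exact hgmax)
  -- Step 3: `H_{S/(g)} ≤ H_{S/I}` from `Ḡ · k[X]_n ⊆ cl_{m+n}((g))`
  have hup : ∀ n, hilbertFun (S ⧸ Ideal.span {eval x G}) n ≤ hilbertFun (S ⧸ I) n := by
    intro n
    have hstar := finrank_initialForms_add_hilbertFun_quotient x hx (Ideal.span {eval x G}) n
    have hHn := hH n
    by_cases hmn : m ≤ n
    · rw [if_pos hmn] at hHn
      obtain ⟨j, rfl⟩ := Nat.exists_eq_add_of_le hmn
      have hc := card_le_finrank_initialForms x hG (Ideal.mem_span_singleton_self _) hG0 j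
      rw [Nat.add_sub_cancel_left] at hHn
      omega
    · rw [if_neg hmn, add_zero] at hHn
      omega
  -- Step 4: `H_{S/I} ≤ H_{S/(g)}` by the surjection `S/(g) → S/I`; equality; injectivity
  letI : Algebra (S ⧸ Ideal.span {eval x G}) (S ⧸ I) := (Ideal.Quotient.factor hle).toAlgebra
  have hsurj : Function.Surjective (algebraMap (S ⧸ Ideal.span {eval x G}) (S ⧸ I)) :=
    Ideal.Quotient.factor_surjective hle
  have heq : hilbertFun (S ⧸ I) = hilbertFun (S ⧸ Ideal.span {eval x G}) :=
    le_antisymm (hilbertFun_le_of_surjective hsurj) fun n => hup n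
  have hker := ker_algebraMap_eq_bot_of_hilbertFun_eq hsurj heq
  refine le_antisymm (fun a ha => ?_) hle
  have hmem : Ideal.Quotient.mk (Ideal.span {eval x G}) a ∈
      RingHom.ker (algebraMap (S ⧸ Ideal.span {eval x G}) (S ⧸ I)) := by
    rw [RingHom.mem_ker]
    change Ideal.Quotient.factor hle (Ideal.Quotient.mk _ a) = 0
    rw [Ideal.Quotient.factor_mk]
    exact Ideal.Quotient.eq_zero_iff_mem.mpr ha
  rw [hker, Ideal.mem_bot, Ideal.Quotient.eq_zero_iff_mem] at hmem
  exact hmem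

end Regular

/-! ## The rigidity theorem for a surjection `S → A` -/

/-- **Hilbert-function rigidity of hypersurfaces (helper H1, ring level).** Let `S` be a regular
local ring of dimension `e`, `f : S → A` a surjection onto a local ring, and assume the Hilbert
function of `A` is that of a hypersurface of multiplicity `m ≥ 1` in embedding dimension `e`:
`H^{(0)}_A(n) + Φ^{(e)}(n - m)·[m ≤ n] = Φ^{(e)}(n)` for all `n` (`Φ^{(e)} = H^{(0)}(k[X_1, …, X_e])`,
CJS Def. 2.13). Then `ker f` is principal, generated by an element of order exactly `m`:
`A ≅ S/(g)`, `g ∈ 𝔪^m ∖ 𝔪^{m+1}`. [OURS · L1 W4.2] helper H1 of `stub_tameNu3` (replaces the role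
of "tame value ⟹ hypersurface point of multiplicity `m`"); NOT a statement of the manuscript.
[cite: CossartJannsenSaito2020, §2.2 (p. 24, 27), Def. 2.13, Lemma 2.24] -/
theorem exists_ker_eq_span_singleton_of_hilbertFun {S : Type u} [CommRing S]
    [IsRegularLocalRing S] {A : Type v} [CommRing A] [IsLocalRing A] (f : S →+* A)
    (hf : Function.Surjective f) {e m : ℕ} (he : ringKrullDim S = e) (hm : 1 ≤ m)
    (hH : ∀ n, hilbertFun A n + (if m ≤ n then iterPSum e Phi (n - m) else 0) = iterPSum e Phi n) :
    ∃ g : S, RingHom.ker f = Ideal.span {g} ∧ g ∈ maximalIdeal S ^ m ∧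
      g ∉ maximalIdeal S ^ (m + 1) := by
  have hd : (maximalIdeal S).spanFinrank = e := by
    have h := IsRegularLocalRing.spanFinrank_maximalIdeal (R := S)
    rw [he] at h
    exact_mod_cast h
  obtain ⟨x, hx⟩ := exists_span_range_eq_maximalIdeal S hd.le
  haveI : Nontrivial (S ⧸ RingHom.ker f) :=
    Ideal.Quotient.nontrivial_iff.mpr (RingHom.ker_ne_top f)
  have hHA : hilbertFun (S ⧸ RingHom.ker f) = hilbertFun A :=
    hilbertFun_eq_of_ringEquiv (RingHom.quotientKerEquivOfSurjective hf)
  exact eq_span_singleton_of_hilbertFun_quotient hd x hx (RingHom.ker f) hm fun n => by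
    rw [hHA, card_monomialsOfDegree_eq_iterPSum, card_monomialsOfDegree_eq_iterPSum]
    exact hH n

/-- **Helper H1 in the planner's closed binomial form** (`L/w42/CRUX-PLAN.md` v1 §2,
`stub_H1_hypersurface_of_hilbertFun`, with `hypersurfaceHFe e m` unfolded): if
`H^{(0)}_A(n) = binom(n+e-1, e-1) - [m ≤ n]·binom(n-m+e-1, e-1)` for all `n`, `m ≥ 2`, then
`ker f = (g)` with `g ∈ 𝔪^m ∖ 𝔪^{m+1}`. (For `e ≥ 1` this is the previous theorem, as
`binom(n+e-1, e-1) = binom(n+e-1, n) = Φ^{(e)}(n)`; for `e = 0` the hypothesis is contradictory: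
`H^{(0)}_A(1) ≤ H^{(0)}_S(1) = 0`.) [OURS · L1 W4.2]; NOT a statement of the manuscript.
[cite: CossartJannsenSaito2020, §2.2 (p. 27), Def. 2.13, Lemma 2.24] -/
theorem exists_ker_eq_span_singleton_of_hilbertFun_eq_choose {S : Type u} [CommRing S]
    [IsRegularLocalRing S] {A : Type v} [CommRing A] [IsLocalRing A] (f : S →+* A)
    (hf : Function.Surjective f) {e m : ℕ} (he : ringKrullDim S = e) (hm : 2 ≤ m)
    (hH : hilbertFun A = fun n =>
      (n + e - 1).choose (e - 1) - if m ≤ n then (n - m + e - 1).choose (e - 1) else 0) :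
    ∃ g : S, RingHom.ker f = Ideal.span {g} ∧ g ∈ maximalIdeal S ^ m ∧
      g ∉ maximalIdeal S ^ (m + 1) := by
  rcases Nat.eq_zero_or_pos e with rfl | he1
  · -- `S` is a field: `H_A(1) ≤ H_S(1) = Φ(1) = 0`, but the formula says `H_A(1) = 1`
    exfalso
    letI : Algebra S A := f.toAlgebra
    have hle : hilbertFun A ≤ hilbertFun S := hilbertFun_le_of_surjective (A := S) (B := A) hf
    have h1 := hle 1
    rw [hH, hilbertFun_eq_iterPSum_Phi_of_isRegularLocalRing S he, iterPSum_zero,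
      Phi_of_ne_zero one_ne_zero] at h1
    have h2 : ¬ m ≤ 1 := by omega
    simp [h2] at h1
  · obtain ⟨e', rfl⟩ : ∃ e', e = e' + 1 := ⟨e - 1, by omega⟩
    refine exists_ker_eq_span_singleton_of_hilbertFun f hf he (by omega) fun n => ?_
    rw [hH, iterPSum_Phi_eq_choose, iterPSum_Phi_eq_choose]
    have h1 : n + (e' + 1) - 1 = n + e' := by omega
    have h3 : e' + 1 - 1 = e' := by omega
    simp only [h1, h3]
    split_ifs with hmn
    · have h2 : n - m + (e' + 1) - 1 = (n - m) + e' := by omega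
      rw [h2, Nat.choose_symm_add (a := n - m) (b := e'), Nat.choose_symm_add (a := n) (b := e')]
      have hmono := Nat.choose_le_choose e' (show n - m + e' ≤ n + e' by omega)
      omega
    · rw [Nat.choose_symm_add (a := n) (b := e')]
      omega

/-- **H1 in the planner's typed form** (`L/w42/helpers-v1.lean`, signature verbatim): `S` regular
local of dimension `e`, `f : S → A` a surjection onto a local ring with
`hilbertFun A = hypersurfaceHFe e m`, `m ≥ 2` ⟹ `ker f = (g)` with `g ∈ 𝔪^m ∖ 𝔪^{m+1}`.
[OURS · L1 W4.2] helper H1 of `stub_tameNu3`; NOT a statement of the manuscript.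
[cite: CossartJannsenSaito2020, §2.2 (p. 27), Def. 2.13, Lemma 2.24] -/
theorem stub_H1_hypersurface_of_hilbertFun {S : Type u} [CommRing S] [IsRegularLocalRing S]
    {A : Type v} [CommRing A] [IsLocalRing A] (f : S →+* A) (hf : Function.Surjective f)
    {e m : ℕ} (he : ringKrullDim S = e) (hm : 2 ≤ m) (hH : hilbertFun A = hypersurfaceHFe e m) :
    ∃ g : S, RingHom.ker f = Ideal.span {g} ∧ g ∈ maximalIdeal S ^ m ∧
      g ∉ maximalIdeal S ^ (m + 1) :=
  exists_ker_eq_span_singleton_of_hilbertFun_eq_choose f hf he hm hH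

/-- **H1 read at a point of a Hilbert–Samuel stratum (H1″ ∘ H1).** If `ψ_Y(y) ≤ N` and
`y ∈ Y(hypersurfaceHFe (N+1) m)` with `m ≥ 2` — at level `N = 3`: `H^3_Y(y) = hypersurfaceHF m`,
the value of a tame maximal stratum — then for every surjection `f : S → 𝒪_{Y,y}` from a regular
local ring `S` of dimension `ψ_Y(y) + 1` (the embedding dimension of `𝒪_{Y,y}`,
`hilbertFun_stalk_one_of_mem_hsStratum`), `ker f = (g)` with `g ∈ 𝔪_S^m ∖ 𝔪_S^{m+1}`:
`𝒪_{Y,y} ≅ S/(g)` is a hypersurface singularity of multiplicity `m`. [OURS · L1 W4.2] step (1) of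
`stub_tameNu3` at the ring level; NOT a statement of the manuscript.
[cite: CossartJannsenSaito2020, Def. 2.28, §2.2 (p. 27), Lemma 2.24] -/
theorem exists_ker_eq_span_singleton_of_mem_hsStratum {Y : Scheme.{u}} {N m : ℕ} {y : Y}
    (hψ : Scheme.hsPsi Y y ≤ N) (hm : 2 ≤ m)
    (hy : y ∈ Scheme.hsStratum Y N (hypersurfaceHFe (N + 1) m))
    {S : Type v} [CommRing S] [IsRegularLocalRing S] (f : S →+* Y.presheaf.stalk y)
    (hf : Function.Surjective f) (he : ringKrullDim S = (Scheme.hsPsi Y y + 1 : ℕ)) :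
    ∃ g : S, RingHom.ker f = Ideal.span {g} ∧ g ∈ maximalIdeal S ^ m ∧
      g ∉ maximalIdeal S ^ (m + 1) :=
  stub_H1_hypersurface_of_hilbertFun f hf he hm ((mem_hsStratum_hypersurfaceHFe_iff hψ).mp hy)

end Summit.ResolutionOfSingularities.ResolutionOfSingularities.Theorems.SigmaMaxModificationsCorridor3.Helpers

end
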